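import Summits.QuantumFields.BalabanUV.InfraRed.StrongCouplingSUNFronts
import Summits.QuantumFields.YangMills.Theorems.Instrument.StrongCouplingMassBaseline
import HarnessLib

/-!
# Instrument cell `ym-instrument`, crew (b), Q-B1 BASELINE — the `SU(3)` companion: the tree's strong-coupling SC-c door for `SU(3)`,
# `d = 4`, as «`m(β)·a ≥ c > 0` for every Wilson `0 ≤ β_W ≤ β_cert`» with ONE explicit `c`, every `β_cert < 9/40`

QUESTIONS.md row: Q-B1 (REGISTERED 2026-08-26T13:54:11Z; reading A-0826-8; SC-PLAN §1 S5 = the `SU(3)` cross-check lineage), cell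
`run/shared/lean/pub/ym-instrument/`, HUMAN RULING D-0084 (2), director-ym R138; currency: the `SU(3)` analogue of row T (SC-c) of
`ym-instrument-sc-ref/REFEREE.md` §2.  HONEST FRAMING (page 1, binding).  WHAT IS CERTIFIED HERE AND AT WHICH `(G, D, L, β)`: `G = SU(3)`,
`D = 4`, Wilson action `β_W Σ_p (1 − ⅓ Re tr U_p)` with `β_W = 6/g²` (tree coupling `β_W/3`, 't Hooft `β_W/9`), EVERY spatial torus `(ℤ/(2S+1))³`
with `S ≥ S₀(β)` (volume-uniform), `β_W ∈ [0, β_cert]` with `β_cert < 9/40 = 0.225`; `m` = the transfer-matrix gap above the vacuum in LATTICE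
units (`CrossoverLedger.LatticeMassGap`), bounded below by the Dobrushin–Kantorovich–Rubinstein rate of the axial door fed with the tree's
Bakry–Émery one-link modulus: `c(β_W) = krRate (14·(β_W/9)/(1/2 − 6·β_W/9)) = −log max(14β_W/(9/2 − 6β_W), 1/2)`.  STRONG-COUPLING SIDE ONLY:
nothing at or beyond `β_W = 9/40`, nothing in the weak window, NOT a gap at weak coupling, NOT a continuum statement, NOT summit-bearing; the rate is a
lower bound of the method, not the mass.  NO NEW ANALYSIS: one-line specialisations of the tree's hypothesis-free
`StrongCouplingSUNFronts.su3_latticeMassGap_lt` (window `0 ≤ β_W < 9/40`) + monotonicity of the Dobrushin constant in `β_W` + the bookkeeping lemmas of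
the landed `SU(2)` file `Instrument.StrongCouplingMassBaseline` (p455748).  BASELINE row: moves no endpoint.

Contents: `su3_dobrushinConst_mono` (the constant `14(β_W/9)/(1/2 − 6β_W/9)` is monotone on `[0, 9/40)`), ★ `su3_latticeMassGap_uniform` (one rate on
all of `[0, β_cert]`, every `β_cert < 9/40`), rows `β_cert = 9/68` (rate `log 2`, the `krRate` floor), `1/5` (rate `log (33/28) = 0.1643…`), `11/50 = 0.22`
(rate `log (159/154) = 0.0320…`; the tree's point instance `su3_latticeMassGap_022` sits here), and `su3_rows_rate_pos_chain`.
-/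

noncomputable section

open Literature.MathematicalPhysics.QuantumLattice (fundamentalRep)
open Literature.MathematicalPhysics.QuantumFieldTheory.Balaban1983to89
open Literature.MathematicalPhysics.QuantumFieldTheory.Balaban1983to89.StrongCouplingTorusWindow (krRate krRate_pos)
open Summit.QuantumFields.BalabanUV.InfraRed.StrongCouplingSUNFronts (su3_latticeMassGap_lt)
open Summit.QuantumFields.YangMills.Theorems.Instrument.StrongCouplingMassBaseline
  (latticeMassGap_mono_rate krRate_anti krRate_eq_neg_log)

namespace Summit.QuantumFields.YangMills.Theorems.Instrument.StrongCouplingMassBaselineSU3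

/-- **The `SU(3)` axial-door Dobrushin constant is monotone in the coupling on `[0, 9/40)`**:
`0 ≤ β ≤ β' < 9/40 ⟹ 14(β/9)/(1/2 − 6β/9) ≤ 14(β'/9)/(1/2 − 6β'/9)` (numerator up, positive denominator down). [folklore] -/
theorem su3_dobrushinConst_mono {β β' : ℝ} (h0 : 0 ≤ β) (hle : β ≤ β') (hlt : β' < 9 / 40) :
    14 * (β / 9) * (1 / (1 / 2 - β / 9 * 6)) ≤ 14 * (β' / 9) * (1 / (1 / 2 - β' / 9 * 6)) := by
  have hd' : 0 < 1 / 2 - β' / 9 * 6 := by linarith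
  have hd : 0 < 1 / 2 - β / 9 * 6 := by linarith
  rw [mul_one_div, mul_one_div]
  exact div_le_div₀ (by linarith) (by linarith) hd' (by linarith)

/-- The `SU(3)` axial-door Dobrushin constant is `< 1` below the window's end: `β < 9/40 ⟹ 14(β/9)/(1/2 − 6β/9) < 1`. [folklore] -/
theorem su3_dobrushinConst_lt_one {β : ℝ} (hlt : β < 9 / 40) :
    14 * (β / 9) * (1 / (1 / 2 - β / 9 * 6)) < 1 := by
  have hd : 0 < 1 / 2 - β / 9 * 6 := by linarith
  rw [mul_one_div, div_lt_one hd]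
  linarith

/-! ## ★ The uniform row -/

/-- ★ **Q-B1 baseline, `SU(3)`, `d = 4` (the tree's SC-c door, uniform form).**  For every `0 ≤ β_cert < 9/40` and every Wilson
`0 ≤ β_W ≤ β_cert`: `LatticeMassGap (fundamentalRep (Fin 3)) (β_W/3) c` with the SINGLE explicit rate
`c = krRate (14·(β_cert/9)/(1/2 − 6β_cert/9)) > 0` (lattice units).  Proof: tree door `su3_latticeMassGap_lt` at `β_W`, antitonicity of `krRate`,
monotonicity of the Dobrushin constant.  Strong-coupling side only; nothing at `β_W ≥ 9/40`. [folklore] -/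
theorem su3_latticeMassGap_uniform {βcert βW : ℝ} (hcert : βcert < 9 / 40) (h0 : 0 ≤ βW) (hle : βW ≤ βcert) :
    CrossoverLedger.LatticeMassGap (fundamentalRep (Fin 3)) (βW / 3)
      (krRate (14 * (βcert / 9) * (1 / (1 / 2 - βcert / 9 * 6)))) :=
  latticeMassGap_mono_rate (su3_latticeMassGap_lt h0 (lt_of_le_of_lt hle hcert))
    (krRate_pos (su3_dobrushinConst_lt_one hcert)) (krRate_anti (su3_dobrushinConst_mono h0 hle hcert))

/-! ## Rows at explicit rationals -/

/-- **Row `β_cert = 9/68 = 0.1323…`** (`g² = 136/3`): `m·a ≥ log 2 = 0.6931…` for every Wilson `0 ≤ β_W ≤ 9/68` (Dobrushin constant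
`14·(1/68)/(1/2 − 6/68) = 1/2`, the floor of `krRate`). [folklore] -/
theorem su3_latticeMassGap_uniform_nineSixtyEighths {βW : ℝ} (h0 : 0 ≤ βW) (hle : βW ≤ 9 / 68) :
    CrossoverLedger.LatticeMassGap (fundamentalRep (Fin 3)) (βW / 3) (Real.log 2) := by
  have h := su3_latticeMassGap_uniform (βcert := 9 / 68) (by norm_num) h0 hle
  have e : krRate (14 * ((9 / 68 : ℝ) / 9) * (1 / (1 / 2 - (9 / 68 : ℝ) / 9 * 6))) = Real.log 2 := by
    rw [show (14 * ((9 / 68 : ℝ) / 9) * (1 / (1 / 2 - (9 / 68 : ℝ) / 9 * 6))) = (2 : ℝ)⁻¹ by norm_num,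
      krRate_eq_neg_log (by norm_num), Real.log_inv, neg_neg]
  rwa [e] at h

/-- **Row `β_cert = 1/5`** (`g² = 30`): `m·a ≥ log (33/28) = 0.1643…` for every Wilson `0 ≤ β_W ≤ 0.2` (Dobrushin constant
`(14/45)/(11/30) = 28/33`). [folklore] -/
theorem su3_latticeMassGap_uniform_fifth {βW : ℝ} (h0 : 0 ≤ βW) (hle : βW ≤ 1 / 5) :
    CrossoverLedger.LatticeMassGap (fundamentalRep (Fin 3)) (βW / 3) (Real.log (33 / 28)) := by
  have h := su3_latticeMassGap_uniform (βcert := 1 / 5) (by norm_num) h0 hle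
  have e : krRate (14 * ((1 / 5 : ℝ) / 9) * (1 / (1 / 2 - (1 / 5 : ℝ) / 9 * 6))) = Real.log (33 / 28) := by
    rw [show (14 * ((1 / 5 : ℝ) / 9) * (1 / (1 / 2 - (1 / 5 : ℝ) / 9 * 6))) = ((33 : ℝ) / 28)⁻¹ by norm_num,
      krRate_eq_neg_log (by norm_num), Real.log_inv, neg_neg]
  rwa [e] at h

/-- **Row `β_cert = 11/50 = 0.22`** (`g² = 300/11`; the tree files the point instance `StrongCouplingSUNFronts.su3_latticeMassGap_022` here;
`0.22 < 9/40 = 0.225`): `m·a ≥ log (159/154) = 0.0320…` for every Wilson `0 ≤ β_W ≤ 0.22` (Dobrushin constant `154/159`). [folklore] -/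
theorem su3_latticeMassGap_uniform_022 {βW : ℝ} (h0 : 0 ≤ βW) (hle : βW ≤ 11 / 50) :
    CrossoverLedger.LatticeMassGap (fundamentalRep (Fin 3)) (βW / 3) (Real.log (159 / 154)) := by
  have h := su3_latticeMassGap_uniform (βcert := 11 / 50) (by norm_num) h0 hle
  have e : krRate (14 * ((11 / 50 : ℝ) / 9) * (1 / (1 / 2 - (11 / 50 : ℝ) / 9 * 6))) = Real.log (159 / 154) := by
    rw [show (14 * ((11 / 50 : ℝ) / 9) * (1 / (1 / 2 - (11 / 50 : ℝ) / 9 * 6))) = ((159 : ℝ) / 154)⁻¹ by norm_num,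
      krRate_eq_neg_log (by norm_num), Real.log_inv, neg_neg]
  rwa [e] at h

/-- The three explicit `SU(3)` rates are positive reals: `0 < log (159/154) < log (33/28) < log 2`. [folklore] -/
theorem su3_rows_rate_pos_chain :
    0 < Real.log (159 / 154) ∧ Real.log (159 / 154) < Real.log (33 / 28) ∧ Real.log (33 / 28) < Real.log 2 :=
  ⟨Real.log_pos (by norm_num), Real.log_lt_log (by norm_num) (by norm_num), Real.log_lt_log (by norm_num) (by norm_num)⟩

end Summit.QuantumFields.YangMills.Theorems.Instrument.StrongCouplingMassBaselineSU3

end
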